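import Mathlib
import HarnessLib
import Summits.CriticalPhenomena.CardyFormulaZ2.Theses.CardySelfRefinement
import Literature.Probability.RandomPlanarGeometry.ChordalReversibility
import Literature.Probability.RandomPlanarGeometry.ConformalRectangle
import Literature.Probability.RandomPlanarGeometry.IsometryCovariance

/-!
# S7 `stub_pinnedSchrammLSW` of line `SketchIdeatorTwo` (crux `SymmetryUpgradeR`, stmt-CriticalPhenomena-17239)
# from the predecessor crux's typed Schramm–LSW stub

The primary back end of the revised line, `stub_pinnedSchrammLSW` (a conformally covariant, achiral, reversible
local Markov chordal family that a.s. traces no boundary arc and is the bond-ℤ² interface limit of clause (iv) is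
chordal SLE₆ in every Dobrushin domain), is — verbatim — a WEAKENING of the registered open stub
`stub_typedSchrammLSW` of line `isotropy-kills-beltrami` for crux `CardyRotToConfR2SymmetryUpgrade`
(stmt-CriticalPhenomena-0698; file `Cruxes/CardyRotToConfR2SymmetryUpgrade/Lines/isotropy-kills-beltrami.lean`):
that stub asks the same conclusion for EVERY conformally covariant local Markov non-tracing family, without clause
(iv), achirality or reversibility. This file records the implication, so that a proof of the predecessor's stub
closes S7 of this line through the ledger.
-/

noncomputable section

namespace Summit.CriticalPhenomena.CardyFormulaZ2.Theorems.SymmetryUpgradeR.SwallowingSkeleton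

open MeasureTheory Filter Set
open Literature.Probability.RandomPlanarGeometry Literature.Probability.LatticeModels
  Literature.Probability.Percolation
open UpperHalfPlane (upperHalfPlaneSet)

/-- **S7 from the typed Schramm–LSW principle.** If every conformally covariant local Markov chordal family that
a.s. traces no boundary arc is chordal SLE₆ in every Dobrushin domain (the statement of `stub_typedSchrammLSW`,
crux stmt-CriticalPhenomena-0698, taken here as a hypothesis), then in particular so is the pinned family of
clause (iv) — the extra hypotheses (iv), `IsIsometryCovariant`, `IsReversible` are simply dropped. -/
theorem pinnedSchrammLSW_of_typedSchrammLSW : (∀ Q : ChordalFamily, IsLocalMarkovChordalFamily Q → (∀ D : DobrushinDomain, ∀ᵐ γ ∂(Q D), ∀ c : Curve ℂ, CurveClass.mk c = γ → ∀ s t : unitInterval, s < t → c '' Set.Icc s t ⊆ frontier D.carrier → (c '' Set.Icc s t).Subsingleton) → Q.IsConformallyCovariant → ∀ D : DobrushinDomain, IsSLELaw 6 D (Q D)) → ∀ P : ChordalFamily, IsLocalMarkovChordalFamily P → (∀ D : DobrushinDomain, ∀ᵐ γ ∂(P D), ∀ c : Curve ℂ, CurveClass.mk c = γ → ∀ s t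 : unitInterval, s < t → c '' Set.Icc s t ⊆ frontier D.carrier → (c '' Set.Icc s t).Subsingleton) → ((∀ (D : DobrushinDomain) (E : ℝ → DiscreteDobrushin), ZdDiscretisationFamily D E → ∀ᶠ δ in nhdsWithin (0 : ℝ) (Set.Ioi 0), AEMeasurable (bondInterfaceIn D (E δ)) (bondPercolation (zdGraph 2) half)) ∧ ∃ δs : ℕ → ℝ, (∀ n, 0 < δs n) ∧ Tendsto δs atTop (nhds 0) ∧ ∀ (D : DobrushinDomain) (E : ℝ → DiscreteDobrushin), ZdDiscretisationFamily D E → ∀ f : BoundedContinuousFunction (CurveClass ℂ) ℝ, Tendsto (fun n => ∫ ω, f (bondInterfaceIn D (E (δs n)) ω) ∂(bondPercolation (zdGraph 2) half)) atTop (nhds (∫ γ, f γ ∂(P D)))) → P.IsConformallyCovariant → P.IsIsometryCovariant → P.IsReversible → ∀ D : DobrushinDomain, IsSLELaw 6 D (P D) :=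
  fun h P hP hnt _hIV hcov _hiso _hrev D => h P hP hnt hcov D

end Summit.CriticalPhenomena.CardyFormulaZ2.Theorems.SymmetryUpgradeR.SwallowingSkeleton

end
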